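import Summits.HubbardSuperconductivity.HubbardSuperconductivity.Theorems.MesoscopicPairOrder.Negative.StonerQuarticBand
import Summits.HubbardSuperconductivity.HubbardSuperconductivity.Theorems.MesoscopicPairOrder.Negative.StonerQuarticMajorants
import Summits.HubbardSuperconductivity.HubbardSuperconductivity.Theorems.MesoscopicPairOrder.Negative.StonerDiamondSea
import Summits.HubbardSuperconductivity.HubbardSuperconductivity.Theorems.MesoscopicPairOrder.Negative.StonerPieceArithmetic
import Mathlib.Analysis.Real.Pi.Bounds
import HarnessLib

/-!
# Crux `MesoscopicPairOrder` (stmt-HubbardSuperconductivity-7331), Negative side: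
# NO NEARLY SATURATED FERROMAGNETISM FOR `U ≤ 11/2` ON `δ ∈ [1/10, 3/10]`

Line `redirect_birth` (lead c11, cycle 3), Negative programme E1. The refuter instruments against the crux body
(`PolarisedExclusion.pointwise_false_of_nearlySaturated`) and against stub (Q)
(`FluctuationFloorPosition.fluctuationFloorAt_false_of_nearlySaturated`) need NEARLY SATURATED sector ground
states (`n - S = o(L²)`) infinitely often. Leads c9/c10 excluded them by a Stoner criterion for `U ≤ 7/2`
(`StonerExactDoublonBox.spinDeficiency_ge_of_coupling_le`: square trial sea, degree-2 hinge majorant). With the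
two inputs landed this cycle — the DIAMOND paired Fermi sea (`StonerDiamondSea.exists_diamondTrialSet_card_eq`,
kinetic energy `-(8/π²) sin²(hπ/L)·L²`, within `0.01 t`/site of the free Fermi sea) and the QUARTIC hinge
majorant through the fourth band moment (`StonerQuarticBand.quartic_spin_le_of_pairedSea_exact`, `Σε⁴ = 36L²`)
— the exclusion reaches `U ≤ 11/2`:

* `quartic_spin_le_of_diamondSea_exact` — the Stoner ceiling fed with both inputs (general `h`, `μ`, `P`);
* the eight quartic majorants `quarticMajorant_260 … quarticMajorant_170` (`μ = 2.6, …, 1.7`, one per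
  `δ`-piece) are the companion file `StonerQuarticMajorants.lean` (Bernstein certificates);
* the model-free piece arithmetic (`exists_diamond_param`, `sine_floor_of_diamond`, `deficiency_piece_arith`:
  concave minimum of `2μn - Un²/L²` at the window endpoints, sine floor at `h/L ≥ √(ν/2) - 2/L`, `π² < 9.8697`)
  is the companion file `StonerPieceArithmetic.lean`; `deficiency_piece` here runs ONE `δ`-piece on the physical
  objects;
* `spinDeficiency_ge_of_coupling_le_eleven_halves` — **for `0 ≤ U ≤ 11/2`, `δ ∈ [1/10, 3/10]`, every
  `L ≥ 20000` and every ground state of the `(2n, S^z = 0)` sector (`n = ⌊(1-δ)L²/2⌋`) with `S² = S(S+1)`,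
  `S ≤ n`: `n - S ≥ L²/1000`** (eight pieces of width `1/40` in `δ`);
* `not_nearlySaturated_frequently_of_coupling_le_eleven_halves` — the near-saturation refuter hypothesis fails on
  `[0, 11/2] × [1/10, 3/10]` (was `[0, 7/2] × …`, p157998).

Reach (work/e1 numerics in the lead folder): continuum Stoner gap `G(δ)/ν² = 6.28 … 6.59`; with both sides exact
`U ≤ 6` would need the hinge within `0.03 t`/site (degree ≥ 8 majorants or pocket Riemann sums) — recorded, not
attempted here. Sources: E. C. Stoner, Proc. R. Soc. A 165 (1938) 372; D. R. Penn, Phys. Rev. 142 (1966) 350 §II;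
H. Tasaki, Prog. Theor. Phys. 99 (1998) 489 §5; G. G. Lorentz, *Bernstein Polynomials* (1953) §1.1 (positivity
certificate). Folklore finite-dimensional statements; no definition, no named fact, no sorry.
-/

noncomputable section

-- the summit namespace repeats the problem name by design (D-0017)
set_option linter.dupNamespace false

namespace Summit.HubbardSuperconductivity.HubbardSuperconductivity.Theorems.MesoscopicPairOrder.Negative

open Matrix Finset Filter
open Literature.Probability.LatticeModels Literature.MathematicalPhysics.QuantumLattice
open scoped ComplexOrder ComplexConjugate

section ElevenHalves

variable {L : ℕ} [NeZero L]

/-! ### The Stoner ceiling with the quartic hinge majorant and the diamond sea -/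

/-- **Quartic hinge + diamond sea**: for `L ≥ 5`, `0 ≤ U`, a ground state `ψ` of the `(2n, S^z = 0)` sector of
`hubbardTorus 2 L 1 U` with `S² ψ = S(S+1) ψ`, `S ≤ n`, a quartic majorant `P ≥ (μ - ·)₊` on `[-4,4]` and a
diamond parameter `h` (`2h + 1 ≤ L`, `2h² + 2h + 1 ≤ n ≤ L²`):
`2μn - L²(p₀ + 4p₂ + 36p₄) + 8((L/π) sin((2h+1)π/L) + 2(L/π)² sin²(hπ/L)) - 8(n - (2h²+2h+1)) - U n²/L² ≤ (μ+4)(n-S)`.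
[folklore] -/
theorem quartic_spin_le_of_diamondSea_exact (hL : 5 ≤ L) {U : ℝ} (hU : 0 ≤ U) {n S : ℕ} (hS : S ≤ n)
    {ψ : Fock (Orb (FermionTorus 2 L))} (hgs : IsGroundStateInSector (hubbardTorus 2 L 1 U) (2 * n) 0 ψ)
    (hspin : spinSq *ᵥ ψ = (((S : ℝ) * ((S : ℝ) + 1) : ℝ) : ℂ) • ψ)
    (h : ℕ) (hm : 2 * h + 1 ≤ L) (hn : 2 * h ^ 2 + 2 * h + 1 ≤ n) (hnL : n ≤ L ^ 2)
    {μ p₀ p₁ p₂ p₃ p₄ : ℝ}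
    (hP : ∀ e : ℝ, -4 ≤ e → e ≤ 4 → max (μ - e) 0 ≤ p₀ + p₁ * e + p₂ * e ^ 2 + p₃ * e ^ 3 + p₄ * e ^ 4) :
    2 * μ * n - (L : ℝ) ^ 2 * (p₀ + 4 * p₂ + 36 * p₄) +
        8 * ((L : ℝ) / Real.pi * Real.sin ((2 * h + 1 : ℕ) * Real.pi / L) +
          2 * ((L : ℝ) / Real.pi) ^ 2 * Real.sin (h * Real.pi / L) ^ 2) -
        8 * ((n - (2 * h ^ 2 + 2 * h + 1) : ℕ) : ℝ) - U * ((n : ℝ) ^ 2 / (L : ℝ) ^ 2) ≤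
      (μ + 4) * ((n : ℝ) - S) := by
  obtain ⟨T, hTcard, hTsum⟩ := exists_diamondTrialSet_card_eq (le_trans (by norm_num) hL) h hm hn hnL
  have hstoner := quartic_spin_le_of_pairedSea_exact hL hU hS hgs hspin (Finset.nodup_toList T)
    (by rw [Finset.length_toList, hTcard]) hP
  rw [Finset.toList_toFinset] at hstoner
  linarith


/-- **ONE `δ`-PIECE.** For `0 ≤ U ≤ U_max`, `δ ∈ [d_lo, d_hi] ⊆ [1/10, 1/2]`, `L ≥ 20000`, a ground state of the
`(2n, S^z = 0)` sector (`n = ⌊(1-δ)L²/2⌋`) with `S² = S(S+1)`, `S ≤ n`, a quartic majorant `P ≥ (μ - ·)₊` on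
`[-4, 4]` (`0 ≤ μ ≤ 4`), a rational `a ∈ [4/5, 1]` with `a² ≤ 1 - d_hi` and the two master inequalities (pure
numerics, checked by `norm_num` at each call): `κ₀ L² ≤ n - S`. [folklore] -/
theorem deficiency_piece {U Umax δ dlo dhi μ p₀ p₁ p₂ p₃ p₄ a κ₀ : ℝ} (hL : 20000 ≤ L)
    (hU0 : 0 ≤ U) (hU : U ≤ Umax) (hδ1 : dlo ≤ δ) (hδ2 : δ ≤ dhi) (hd0 : 1 / 10 ≤ dlo) (hd1 : dhi ≤ 1 / 2)
    {ψ : Fock (Orb (FermionTorus 2 L))}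
    (hgs : IsGroundStateInSector (hubbardTorus 2 L 1 U) (2 * ⌊(1 - δ) * (L : ℝ) ^ 2 / 2⌋₊) 0 ψ)
    {S : ℕ} (hS : S ≤ ⌊(1 - δ) * (L : ℝ) ^ 2 / 2⌋₊)
    (hspin : spinSq *ᵥ ψ = (((S : ℝ) * ((S : ℝ) + 1) : ℝ) : ℂ) • ψ)
    (hP : ∀ e : ℝ, -4 ≤ e → e ≤ 4 → max (μ - e) 0 ≤ p₀ + p₁ * e + p₂ * e ^ 2 + p₃ * e ^ 3 + p₄ * e ^ 4)
    (hμ0 : 0 ≤ μ) (hμ4 : μ ≤ 4) (ha2 : a ^ 2 ≤ 1 - dhi) (ha0 : 4 / 5 ≤ a) (ha1 : a ≤ 1)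
    (hm_lo : (μ + 4) * κ₀ + 1 / 500 ≤ 2 * μ * ((1 - dhi) / 2) - Umax * ((1 - dhi) / 2) ^ 2 -
      (p₀ + 4 * p₂ + 36 * p₄) +
      16 * (1 - (3141593 / 1000000 * (1 / 2 - a / 2 + 1 / 10000)) ^ 2 / 2) ^ 2 / (98697 / 10000))
    (hm_hi : (μ + 4) * κ₀ + 1 / 500 ≤ 2 * μ * ((1 - dlo) / 2) - Umax * ((1 - dlo) / 2) ^ 2 -
      (p₀ + 4 * p₂ + 36 * p₄) +
      16 * (1 - (3141593 / 1000000 * (1 / 2 - a / 2 + 1 / 10000)) ^ 2 / 2) ^ 2 / (98697 / 10000)) :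
    κ₀ * (L : ℝ) ^ 2 ≤ ((⌊(1 - δ) * (L : ℝ) ^ 2 / 2⌋₊ - S : ℕ) : ℝ) := by
  set n : ℕ := ⌊(1 - δ) * (L : ℝ) ^ 2 / 2⌋₊ with hn_def
  have hL5 : 5 ≤ L := le_trans (by norm_num) hL
  have hLr : (20000 : ℝ) ≤ L := by exact_mod_cast hL
  have hLpos : (0 : ℝ) < L := by linarith
  -- the filling in real terms
  have hx0 : 0 ≤ (1 - δ) * (L : ℝ) ^ 2 / 2 := by
    have : 0 ≤ 1 - δ := by linarith
    positivity
  have hn_le : (n : ℝ) ≤ (1 - δ) * (L : ℝ) ^ 2 / 2 := Nat.floor_le hx0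
  have hn_ge : (1 - δ) * (L : ℝ) ^ 2 / 2 - 1 ≤ (n : ℝ) := by
    have := Nat.lt_floor_add_one ((1 - δ) * (L : ℝ) ^ 2 / 2)
    linarith
  obtain ⟨hn_lo, hn_hi, hn1r, hn45⟩ := filling_bounds_piece hLr hδ1 hδ2 hd0 hd1 hn_le hn_ge
  have hn1 : 1 ≤ n := by exact_mod_cast hn1r
  have hnL : n ≤ L ^ 2 := by
    have : (n : ℝ) ≤ (L : ℝ) ^ 2 := by linarith [sq_nonneg (L : ℝ)]
    exact_mod_cast this
  -- the largest diamond
  obtain ⟨h, hD1, hD2⟩ := exists_diamond_param hn1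
  have hD1r : (2 * (h : ℝ) ^ 2 + 2 * h + 1) ≤ (n : ℝ) := by exact_mod_cast hD1
  have hD2r : (n : ℝ) < 2 * (h : ℝ) ^ 2 + 6 * h + 5 := by exact_mod_cast hD2
  have hh0 : (0 : ℝ) ≤ h := by positivity
  -- `2h² ≤ (9/20) L²`, so `h ≤ (19/40) L`, `2h + 1 ≤ L`, `h ≤ L/2`
  have hh2 : (h : ℝ) ^ 2 ≤ ((19 : ℝ) / 40 * L) ^ 2 := by
    have e : ((19 : ℝ) / 40 * L) ^ 2 = 361 / 1600 * (L : ℝ) ^ 2 := by ring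
    rw [e]; linarith [hD1r, hn45, hh0, sq_nonneg (L : ℝ)]
  have hhL' : (h : ℝ) ≤ (19 : ℝ) / 40 * L := le_of_pow_le_pow_left₀ two_ne_zero (by positivity) hh2
  have hhL : (h : ℝ) ≤ L / 2 := by linarith
  have hm2 : 2 * h + 1 ≤ L := by
    have : (2 * h + 1 : ℝ) ≤ L := by linarith
    exact_mod_cast this
  -- the Stoner ceiling with both inputs
  have hstoner := quartic_spin_le_of_diamondSea_exact hL5 hU0 hS hgs hspin h hm2 hD1 hnL hP
  -- the sine floor
  have hsq : (2 * (h : ℝ) + 3) ^ 2 = 4 * (h : ℝ) ^ 2 + 12 * h + 9 := by ring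
  have hbig : 2 * ((1 - dhi) / 2) * (L : ℝ) ^ 2 - 3 < (2 * (h : ℝ) + 3) ^ 2 := by
    rw [hsq]; linarith
  have ha2' : a ^ 2 ≤ 2 * ((1 - dhi) / 2) := by linarith
  have hsin := sine_floor_of_diamond hLr hh0 hbig hhL ha2' ha0 ha1
  -- the surplus momenta and the nonnegative Dirichlet term
  have hsur : ((n - (2 * h ^ 2 + 2 * h + 1) : ℕ) : ℝ) ≤ 4 * (L : ℝ) + 3 := by
    have h1 : n - (2 * h ^ 2 + 2 * h + 1) ≤ 4 * h + 3 := by omega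
    have h2 : ((n - (2 * h ^ 2 + 2 * h + 1) : ℕ) : ℝ) ≤ 4 * (h : ℝ) + 3 := by exact_mod_cast h1
    linarith
  have hX : 0 ≤ (L : ℝ) / Real.pi * Real.sin ((2 * h + 1 : ℕ) * Real.pi / L) := by
    apply mul_nonneg (by positivity)
    apply Real.sin_nonneg_of_nonneg_of_le_pi (by positivity)
    rw [div_le_iff₀ hLpos]
    have h1 : ((2 * h + 1 : ℕ) : ℝ) ≤ L := by exact_mod_cast hm2
    calc ((2 * h + 1 : ℕ) : ℝ) * Real.pi ≤ (L : ℝ) * Real.pi := mul_le_mul_of_nonneg_right h1 Real.pi_pos.le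
      _ = Real.pi * L := mul_comm _ _
  have hcs0 : (0 : ℝ) ≤ 1 - (3141593 / 1000000 * (1 / 2 - a / 2 + 1 / 10000)) ^ 2 / 2 := by
    have hτ0 : (0 : ℝ) ≤ 1 / 2 - a / 2 + 1 / 10000 := by linarith
    have hτ1 : (1 : ℝ) / 2 - a / 2 + 1 / 10000 ≤ 11 / 100 := by linarith
    have h1 : (3141593 / 1000000 * (1 / 2 - a / 2 + 1 / 10000)) ^ 2 ≤ (3141593 / 1000000 * (11 / 100 : ℝ)) ^ 2 :=
      pow_le_pow_left₀ (by positivity) (by linarith) 2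
    have h2 : (3141593 / 1000000 * (11 / 100 : ℝ)) ^ 2 ≤ 1 := by norm_num
    linarith
  rw [Nat.cast_sub hS]
  exact deficiency_piece_arith hLr hU0 hU hn_lo hn_hi (by linarith) hstoner hX hsin hcs0 hsur hμ0 hμ4 hm_lo hm_hi

/-! ### The box `[0, 11/2] × [1/10, 3/10]` -/

/-- **EXTENSIVE SPIN DEFICIENCY FOR `U ≤ 11/2`.** For `0 ≤ U ≤ 11/2`, `δ ∈ [1/10, 3/10]`, every `L ≥ 20000` and
every ground state `ψ` of the `(2n, S^z = 0)` sector (`n = ⌊(1-δ)L²/2⌋`) of `hubbardTorus 2 L 1 U` with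
`S² ψ = S(S+1) ψ`, `S ≤ n`: `L²/1000 ≤ n - S` (eight `δ`-pieces of width `1/40`, quartic hinge majorants at
`μ = 2.6, 2.4, 2.3, 2.2, 2.1, 2.0, 1.9, 1.7`, diamond trial seas). Stoner (1938); Penn (1966); Tasaki (1998) §5.
[folklore] -/
theorem spinDeficiency_ge_of_coupling_le_eleven_halves {U δ : ℝ} (hU : U ∈ Set.Icc (0:ℝ) (11 / 2))
    (hδ : δ ∈ Set.Icc (1 / 10 : ℝ) (3 / 10)) {L : ℕ} [NeZero L] (hL : 20000 ≤ L)
    {ψ : Fock (Orb (FermionTorus 2 L))}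
    (hgs : IsGroundStateInSector (hubbardTorus 2 L 1 U) (2 * ⌊(1 - δ) * (L : ℝ) ^ 2 / 2⌋₊) 0 ψ)
    {S : ℕ} (hS : S ≤ ⌊(1 - δ) * (L : ℝ) ^ 2 / 2⌋₊)
    (hspin : spinSq *ᵥ ψ = (((S : ℝ) * ((S : ℝ) + 1) : ℝ) : ℂ) • ψ) :
    (L : ℝ) ^ 2 / 1000 ≤ ((⌊(1 - δ) * (L : ℝ) ^ 2 / 2⌋₊ - S : ℕ) : ℝ) := by
  obtain ⟨hU0, hU1⟩ := hU
  obtain ⟨hδ1, hδ2⟩ := hδ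
  rw [show (L : ℝ) ^ 2 / 1000 = 1 / 1000 * (L : ℝ) ^ 2 by ring]
  by_cases hc0 : δ ≤ 1 / 8
  · exact deficiency_piece (Umax := 11 / 2) (dlo := 1 / 10) (dhi := 1 / 8) (μ := 13 / 5)
      (p₀ := 26099 / 10000) (p₁ := (-20429 / 20000)) (p₂ := 23 / 20000) (p₃ := 1187 / 100000) (p₄ := 297 / 100000)
      (a := 4677 / 5000) (κ₀ := 1 / 1000) hL hU0 hU1 (by linarith) (by linarith) (by norm_num) (by norm_num)
      hgs hS hspin quarticMajorant_260 (by norm_num) (by norm_num) (by norm_num) (by norm_num) (by norm_num)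
      (by norm_num) (by norm_num)
  · push Not at hc0
    by_cases hc1 : δ ≤ 3 / 20
    · exact deficiency_piece (Umax := 11 / 2) (dlo := 1 / 8) (dhi := 3 / 20) (μ := 12 / 5)
        (p₀ := 4811 / 2000) (p₁ := (-12727 / 12500)) (p₂ := 77 / 10000) (p₃ := 701 / 50000) (p₄ := 39 / 12500)
        (a := 9219 / 10000) (κ₀ := 1 / 1000) hL hU0 hU1 (by linarith) (by linarith) (by norm_num) (by norm_num)
        hgs hS hspin quarticMajorant_240 (by norm_num) (by norm_num) (by norm_num) (by norm_num) (by norm_num)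
        (by norm_num) (by norm_num)
    · push Not at hc1
      by_cases hc2 : δ ≤ 7 / 40
      · exact deficiency_piece (Umax := 11 / 2) (dlo := 3 / 20) (dhi := 7 / 40) (μ := 23 / 10)
          (p₀ := 23037 / 10000) (p₁ := (-101583 / 100000)) (p₂ := 233 / 20000) (p₃ := 19 / 1250) (p₄ := 317 / 100000)
          (a := 4541 / 5000) (κ₀ := 1 / 1000) hL hU0 hU1 (by linarith) (by linarith) (by norm_num) (by norm_num)
          hgs hS hspin quarticMajorant_230 (by norm_num) (by norm_num) (by norm_num) (by norm_num) (by norm_num)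
          (by norm_num) (by norm_num)
      · push Not at hc2
        by_cases hc3 : δ ≤ 1 / 5
        · exact deficiency_piece (Umax := 11 / 2) (dlo := 7 / 40) (dhi := 1 / 5) (μ := 11 / 5)
            (p₀ := 881 / 400) (p₁ := (-101277 / 100000)) (p₂ := 1593 / 100000) (p₃ := 821 / 50000) (p₄ := 161 / 50000)
            (a := 559 / 625) (κ₀ := 1 / 1000) hL hU0 hU1 (by linarith) (by linarith) (by norm_num) (by norm_num)
            hgs hS hspin quarticMajorant_220 (by norm_num) (by norm_num) (by norm_num) (by norm_num) (by norm_num)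
            (by norm_num) (by norm_num)
        · push Not at hc3
          by_cases hc4 : δ ≤ 9 / 40
          · exact deficiency_piece (Umax := 11 / 2) (dlo := 1 / 5) (dhi := 9 / 40) (μ := 21 / 10)
              (p₀ := 2101 / 1000) (p₁ := (-50319 / 50000)) (p₂ := 553 / 25000) (p₃ := 1743 / 100000) (p₄ := 311 / 100000)
              (a := 8803 / 10000) (κ₀ := 1 / 1000) hL hU0 hU1 (by linarith) (by linarith) (by norm_num) (by norm_num)
              hgs hS hspin quarticMajorant_210 (by norm_num) (by norm_num) (by norm_num) (by norm_num) (by norm_num)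
              (by norm_num) (by norm_num)
          · push Not at hc4
            by_cases hc5 : δ ≤ 1 / 4
            · exact deficiency_piece (Umax := 11 / 2) (dlo := 9 / 40) (dhi := 1 / 4) (μ := 2)
                (p₀ := 20003 / 10000) (p₁ := (-5007 / 5000)) (p₂ := 2707 / 100000) (p₃ := 1867 / 100000) (p₄ := 317 / 100000)
                (a := 433 / 500) (κ₀ := 1 / 1000) hL hU0 hU1 (by linarith) (by linarith) (by norm_num) (by norm_num)
                hgs hS hspin quarticMajorant_200 (by norm_num) (by norm_num) (by norm_num) (by norm_num) (by norm_num)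
                (by norm_num) (by norm_num)
            · push Not at hc5
              by_cases hc6 : δ ≤ 11 / 40
              · exact deficiency_piece (Umax := 11 / 2) (dlo := 1 / 4) (dhi := 11 / 40) (μ := 19 / 10)
                  (p₀ := 2377 / 1250) (p₁ := (-1979 / 2000)) (p₂ := 3491 / 100000) (p₃ := 1923 / 100000) (p₄ := 291 / 100000)
                  (a := 4257 / 5000) (κ₀ := 1 / 1000) hL hU0 hU1 (by linarith) (by linarith) (by norm_num) (by norm_num)
                  hgs hS hspin quarticMajorant_190 (by norm_num) (by norm_num) (by norm_num) (by norm_num) (by norm_num)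
                  (by norm_num) (by norm_num)
              · push Not at hc6
                exact deficiency_piece (Umax := 11 / 2) (dlo := 11 / 40) (dhi := 3 / 10) (μ := 17 / 10)
                  (p₀ := 17073 / 10000) (p₁ := (-96679 / 100000)) (p₂ := 1213 / 25000) (p₃ := 259 / 12500) (p₄ := 269 / 100000)
                  (a := 4183 / 5000) (κ₀ := 1 / 1000) hL hU0 hU1 (by linarith) (by linarith) (by norm_num) (by norm_num)
                  hgs hS hspin quarticMajorant_170 (by norm_num) (by norm_num) (by norm_num) (by norm_num) (by norm_num)
                  (by norm_num) (by norm_num)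

/-- **The near-saturation refuter hypothesis fails for `U ≤ 11/2`.** For `(U, δ) ∈ [0, 11/2] × [1/10, 3/10]` it
is NOT the case that for every `κ > 0` nearly saturated sector ground states (`n - S ≤ κL²`) occur along
infinitely many even sides (`κ = 1/2000`, `L ≥ 20000`, `spinDeficiency_ge_of_coupling_le_eleven_halves`). So
`pointwise_false_of_nearlySaturated` and `fluctuationFloorAt_false_of_nearlySaturated` cannot fire on
`[0, 11/2] × [1/10, 3/10]` (was `[0, 7/2] × …`, `not_nearlySaturated_frequently_of_coupling_le`). [folklore] -/
theorem not_nearlySaturated_frequently_of_coupling_le_eleven_halves {U δ : ℝ} (hU : U ∈ Set.Icc (0:ℝ) (11 / 2))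
    (hδ : δ ∈ Set.Icc (1 / 10 : ℝ) (3 / 10)) :
    ¬ ∀ κ : ℝ, 0 < κ → ∃ᶠ L : ℕ in atTop, Even L ∧
      ∃ (ψ : Fock (Orb (FermionTorus 2 L))) (S : ℕ), S ≤ ⌊(1 - δ) * (L : ℝ) ^ 2 / 2⌋₊ ∧
        IsGroundStateInSector (hubbardTorus 2 L 1 U) (2 * ⌊(1 - δ) * (L : ℝ) ^ 2 / 2⌋₊) 0 ψ ∧
          spinSq *ᵥ ψ = (((S : ℝ) * ((S : ℝ) + 1) : ℝ) : ℂ) • ψ ∧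
            ((⌊(1 - δ) * (L : ℝ) ^ 2 / 2⌋₊ - S : ℕ) : ℝ) ≤ κ * (L : ℝ) ^ 2 := by
  intro hns
  obtain ⟨L, ⟨-, ψ, S, hS, hgs, hspin, hdef⟩, hLge⟩ :=
    ((hns (1 / 2000) (by norm_num)).and_eventually (eventually_ge_atTop 20000)).exists
  haveI : NeZero L := ⟨by omega⟩
  have h := spinDeficiency_ge_of_coupling_le_eleven_halves hU hδ hLge hgs hS hspin
  have hLpos : (0 : ℝ) < L := by exact_mod_cast (show 0 < L by omega)
  nlinarith [sq_nonneg (L : ℝ), mul_pos hLpos hLpos]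

/-- Registered sub-goal form (item stmt-HubbardSuperconductivity-7331, line `redirect_birth`, lead c11): NO NEARLY
SATURATED FERROMAGNETISM FOR `U ≤ 11/2` on `δ ∈ [1/10, 3/10]`. [folklore] -/
theorem notNearlySaturatedFrequentlyOfCouplingLeElevenHalves : ∀ {U δ : ℝ}, U ∈ Set.Icc (0:ℝ) (11 / 2) →
    δ ∈ Set.Icc (1 / 10 : ℝ) (3 / 10) → ¬ ∀ κ : ℝ, 0 < κ → ∃ᶠ L : ℕ in Filter.atTop, Even L ∧
      ∃ (ψ : Fock (Orb (FermionTorus 2 L))) (S : ℕ), S ≤ ⌊(1 - δ) * (L : ℝ) ^ 2 / 2⌋₊ ∧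
        IsGroundStateInSector (hubbardTorus 2 L 1 U) (2 * ⌊(1 - δ) * (L : ℝ) ^ 2 / 2⌋₊) 0 ψ ∧
          spinSq *ᵥ ψ = (((S : ℝ) * ((S : ℝ) + 1) : ℝ) : ℂ) • ψ ∧
            ((⌊(1 - δ) * (L : ℝ) ^ 2 / 2⌋₊ - S : ℕ) : ℝ) ≤ κ * (L : ℝ) ^ 2 :=
  fun hU hδ => not_nearlySaturated_frequently_of_coupling_le_eleven_halves hU hδ

end ElevenHalves

end Summit.HubbardSuperconductivity.HubbardSuperconductivity.Theorems.MesoscopicPairOrder.Negative
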